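import Mathlib

/-!
# Literature.Probability.FitznerVanDerHofstad2017.BinomialCoincidenceMonotone — the two-coordinate core of the
d-monotonicity of the SRW transition probabilities for EVERY endpoint

CITATION HEADER (PLACEMENT v2). Build `lace`, node N52 (i) / obligations O1a–O1b of `HOME/b2b-lace-num5-g5/RESULTS.md`
§4 (seat dmps-g13); paper proof `HOME/b2b-lace-dmps-g13/DMONO-ALLX.md`.  Context: R. Fitzner, R. van der Hofstad,
*NoBLE for lattice trees and lattice animals*, J. Stat. Phys. 185 (2021) 13 [FvdH21, = bib key
FitznerVanDerHofstad2021LTLA], §9 "monotonicity in the dimension": Lemma 9.2 there proves that the SRW integrals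
`I_{n,0}(x; d)` are non-increasing in `d` only for `‖x‖_∞ ≤ 2` (Bessel representation of [HS92b]); the tree has the
cases `x = 0` and `x = e_μ` for every `l` (`SrwIntegralDimMonotoneAll.lean`).  The statement for EVERY `x`,
`p_N^{(d+1)}((x,0)) ≤ p_N^{(d)}(x)` (hence `I_{n,l}` monotone in `d` for all `n, l, x`), reduces — by conditioning on the
number of steps spent in a pair of coordinates and a chain of `d` rate transfers ("T-transforms") — to ONE planar
inequality, proved in this file in its binomial form:

**Theorem (`binCoincidence_antitoneOn`).** For all `P, Q : ℕ`, the coincidence probability of two independent binomial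
variables with the same parameter, `T_{P,Q}(γ) = P(Bin(P,γ) = Bin(Q,γ)) = Σ_j C(P,j) C(Q,j) γ^{2j} (1-γ)^{P+Q-2j}`, is
non-increasing in `γ` on `[0, 1/2]`.

(For the planar walk stepping in coordinate 1 with probability `1-γ` and in coordinate 2 with probability `γ`, the
probability to be at `(a, 0)` after `M` steps is `q_M(a) · T_{(M+a)/2,(M-a)/2}(γ)`; see DMONO-ALLX §3.)

Proof (DMONO-ALLX §3, all elementary): with `X' ~ Bin(p)`, `Y' ~ Bin(q)` (`P = p+1`, `Q = q+1`), `d_k = P(X'-Y' = k)`,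
`A = P(1-γ) - Qγ`, `B = Q(1-γ) - Pγ`: (1) `T' = -(A (d₀ - d₋₁) + B (d₀ - d₁))` (`hasDerivAt_binCoincidence`, from the
weight derivative `w_{p+1}(j)' = (p+1)(w_p(j-1) - w_p(j))` and Pascal); (2) the mean identity
`P(1-γ) d₋₁ + γ(P-Q) d₀ = Q(1-γ) d₁` (`dLaw_mean_identity`); (3) log-concavity `d₁ d₋₁ ≤ d₀²` (`dLaw_lc`, by the 2×2
Cauchy–Binet/Lagrange identity and `C(n,i)C(n,j+1) ≤ C(n,j)C(n,i+1)` for `i ≤ j`); (4) a division-free case analysis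
(`E_nonneg`).  Everything is a finite sum of binomial weights `w n i γ = C(n,i) γ^i (1-γ)^(n-i)`; no probability
theory is imported.  Nothing here is a cited fact: definitions and theorems proved from Mathlib.

API, as used by the consumers `SrwLawRates.lean` (rate-walk operator calculus on `(Fin D → ℤ) → ℝ`; master formula
`RateWalk.rwLaw_pairRates_apply`, pair-antitonicity `RateWalk.rwLaw_pairRates_antitoneOn`) and
`SrwLawDimMonotoneAllX.lean` (`RateWalk.srwLaw_dim_succ_le_allx`, `srwI_dim_succ_le_allx`, `srwLaw_dim_anti_allx`,
`srwI_dim_anti_allx`): the binomial weights `BinCoincidence.w n i γ = C(n,i) γ^i (1-γ)^(n-i)` with `w_nonneg`,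
`w_eq_zero_of_lt`, `w_at_zero`, `w_zero_zero`, `w_succ_zero`, `w_succ_succ`, `hasDerivAt_w_zero/_succ`; the coincidence
sum `BinCoincidence.binCoincidence P Q γ = Σ_{j < P+Q+1} w P j γ · w Q j γ` (the terms with `j > min P Q` vanish by
`w_eq_zero_of_lt`) with `binCoincidence_comm`,
`binCoincidence_zero_left/_right`, `binCoincidence_at_zero`, `binCoincidence_nonneg`, `binCoincidence_antitoneOn`; and the
namespace-level export `binomialCoincidence_antitoneOn`.  The auxiliary laws `d0`, `dPlus`, `dMinus`, the functional `E`
and `Tderiv` are internal to the proof.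

[folklore]
-/

noncomputable section

open Finset Set

namespace Literature.Probability.FitznerVanDerHofstad2017

namespace BinCoincidence

/-- The binomial weight `w n i γ = C(n,i) γ^i (1-γ)^(n-i)`, i.e. `P(Bin(n,γ) = i)` (and `0` for `i > n`). [folklore] -/
def w (n i : ℕ) (γ : ℝ) : ℝ := (n.choose i : ℝ) * γ ^ i * (1 - γ) ^ (n - i)

/-- `w n i = 0` for `i > n`. [folklore] -/
theorem w_eq_zero_of_lt {n i : ℕ} (h : n < i) (γ : ℝ) : w n i γ = 0 := by
  simp [w, Nat.choose_eq_zero_of_lt h]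

/-- Binomial weights are non-negative for `γ ∈ [0,1]`. [folklore] -/
theorem w_nonneg {γ : ℝ} (h0 : 0 ≤ γ) (h1 : γ ≤ 1) (n i : ℕ) : 0 ≤ w n i γ := by
  unfold w
  have : 0 ≤ 1 - γ := by linarith
  positivity

/-- `w n 0 γ = (1-γ)^n`. [folklore] -/
theorem w_at_zero (n : ℕ) (γ : ℝ) : w n 0 γ = (1 - γ) ^ n := by simp [w]

/-- `w 0 0 = 1`. [folklore] -/
theorem w_zero_zero (γ : ℝ) : w 0 0 γ = 1 := by simp [w]

/-- Pascal's rule for binomial weights: `w (n+1) (i+1) = (1-γ)·w n (i+1) + γ·w n i`. [folklore] -/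
theorem w_succ_succ (n i : ℕ) (γ : ℝ) :
    w (n + 1) (i + 1) γ = (1 - γ) * w n (i + 1) γ + γ * w n i γ := by
  unfold w
  rw [Nat.choose_succ_succ', Nat.cast_add, Nat.succ_sub_succ]
  rcases Nat.lt_or_ge n (i + 1) with h | h
  · rw [Nat.choose_eq_zero_of_lt h]
    have hi : n - i = 0 ∨ i = n := by omega
    rcases Nat.lt_or_ge n i with h' | h'
    · rw [Nat.choose_eq_zero_of_lt h']; simp
    · have : i = n := by omega
      subst this
      simp; ring
  · have : n - i = (n - (i + 1)) + 1 := by omega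
    rw [this, pow_succ]; ring

/-- Pascal's rule at `i = 0`: `w (n+1) 0 = (1-γ)·w n 0`. [folklore] -/
theorem w_succ_zero (n : ℕ) (γ : ℝ) : w (n + 1) 0 γ = (1 - γ) * w n 0 γ := by
  simp [w, pow_succ]; ring

/-- Derivative of a binomial weight with positive index:
`(w (n+1) (i+1))' = (n+1)·(w n i - w n (i+1))`. [folklore] -/
theorem hasDerivAt_w_succ (n i : ℕ) (γ : ℝ) :
    HasDerivAt (fun x => w (n + 1) (i + 1) x) (((n : ℝ) + 1) * (w n i γ - w n (i + 1) γ)) γ := by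
  have h1 : HasDerivAt (fun x : ℝ => x ^ (i + 1)) (((i + 1 : ℕ) : ℝ) * γ ^ (i + 1 - 1)) γ := hasDerivAt_pow (i + 1) γ
  have h2 : HasDerivAt (fun x : ℝ => 1 - x) (-1) γ := by
    simpa using (hasDerivAt_id γ).const_sub (1 : ℝ)
  have h3 : HasDerivAt (fun x : ℝ => (1 - x) ^ (n + 1 - (i + 1)))
      (((n + 1 - (i + 1) : ℕ) : ℝ) * (1 - γ) ^ (n + 1 - (i + 1) - 1) * (-1)) γ := h2.pow (n + 1 - (i + 1))
  have h4 := (h1.mul h3).const_mul (((n + 1).choose (i + 1) : ℕ) : ℝ)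
  have hfun : (fun x => w (n + 1) (i + 1) x)
      = fun x : ℝ => (((n + 1).choose (i + 1) : ℕ) : ℝ) * (x ^ (i + 1) * (1 - x) ^ (n + 1 - (i + 1))) := by
    ext x; simp only [w]; ring
  rw [hfun]
  refine h4.congr_deriv ?_
  -- `C(n+1,i+1)(i+1) = (n+1) C(n,i)` and `C(n+1,i+1)(n-i) = (n+1) C(n,i+1)`
  have e1 : (((n + 1).choose (i + 1) : ℕ) : ℝ) * ((i + 1 : ℕ) : ℝ) = ((n : ℝ) + 1) * (n.choose i : ℝ) := by
    have h' : ((n + 1).choose (i + 1)) * (i + 1) = (n + 1) * n.choose i := by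
      rw [Nat.add_one_mul_choose_eq n i]
    exact_mod_cast h'
  have e2 : (((n + 1).choose (i + 1) : ℕ) : ℝ) * ((n - i : ℕ) : ℝ) = ((n : ℝ) + 1) * (n.choose (i + 1) : ℝ) := by
    have h' : ((n + 1).choose (i + 1)) * (n - i) = (n + 1) * n.choose (i + 1) := by
      have := Nat.choose_mul_succ_eq n (i + 1)
      -- this : n.choose (i+1) * (n+1) = (n+1).choose (i+1) * (n + 1 - (i + 1))
      rw [Nat.add_sub_add_right] at this
      rw [← this, Nat.mul_comm]
    exact_mod_cast h'
  simp only [Nat.add_sub_cancel, Nat.add_sub_add_right, w]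
  rw [← Nat.sub_sub]
  linear_combination (γ ^ i * (1 - γ) ^ (n - i)) * e1 - (γ ^ (i + 1) * (1 - γ) ^ (n - i - 1)) * e2

/-- Derivative of the zero-index weight: `(w (n+1) 0)' = -(n+1)·w n 0`. [folklore] -/
theorem hasDerivAt_w_zero (n : ℕ) (γ : ℝ) :
    HasDerivAt (fun x => w (n + 1) 0 x) (-(((n : ℝ) + 1) * w n 0 γ)) γ := by
  have h2 : HasDerivAt (fun x : ℝ => 1 - x) (-1) γ := by
    simpa using (hasDerivAt_id γ).const_sub (1 : ℝ)
  have h3 := h2.pow (n + 1)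
  have hfun : (fun x => w (n + 1) 0 x) = fun x : ℝ => (1 - x) ^ (n + 1) := by
    ext x; simp [w]
  rw [hfun]
  refine h3.congr_deriv ?_
  simp only [Nat.add_sub_cancel, w_at_zero]
  push_cast; ring

/-- Absorption/swap identity `(p+1)·w p i·w (q+1) (i+1) = (q+1)·w (p+1) (i+1)·w q i`
(both equal `(p+1)(q+1)/(i+1) · C(p,i) C(q,i) γ^{2i+1} (1-γ)^{p+q-2i}`). [folklore] -/
theorem absorb_swap (p q i : ℕ) (γ : ℝ) :
    ((p : ℝ) + 1) * (w p i γ * w (q + 1) (i + 1) γ) = ((q : ℝ) + 1) * (w (p + 1) (i + 1) γ * w q i γ) := by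
  have key : (p + 1) * (p.choose i * (q + 1).choose (i + 1)) = (q + 1) * ((p + 1).choose (i + 1) * q.choose i) := by
    have h1 := Nat.add_one_mul_choose_eq q i
    have h2 := Nat.add_one_mul_choose_eq p i
    apply Nat.eq_of_mul_eq_mul_right (Nat.succ_pos i)
    calc (p + 1) * (p.choose i * (q + 1).choose (i + 1)) * (i + 1)
        = (p + 1) * p.choose i * ((q + 1).choose (i + 1) * (i + 1)) := by ring
      _ = (p + 1) * p.choose i * ((q + 1) * q.choose i) := by rw [h1]
      _ = (q + 1) * q.choose i * ((p + 1) * p.choose i) := by ring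
      _ = (q + 1) * q.choose i * ((p + 1).choose (i + 1) * (i + 1)) := by rw [h2]
      _ = (q + 1) * ((p + 1).choose (i + 1) * q.choose i) * (i + 1) := by ring
  have key' : ((p : ℝ) + 1) * ((p.choose i : ℝ) * ((q + 1).choose (i + 1) : ℝ))
      = ((q : ℝ) + 1) * (((p + 1).choose (i + 1) : ℝ) * (q.choose i : ℝ)) := by
    exact_mod_cast key
  unfold w
  simp only [Nat.succ_sub_succ]
  linear_combination (γ ^ i * (1 - γ) ^ (p - i) * (γ ^ (i + 1) * (1 - γ) ^ (q - i))) * key'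

/-- Log-concavity of the binomial weights at distance: for `i ≤ j` and `γ ∈ [0,1]`,
`w n i · w n (j+1) ≤ w n j · w n (i+1)`. [folklore] -/
theorem w_ratio_mono (n : ℕ) {i j : ℕ} (hij : i ≤ j) {γ : ℝ} (h0 : 0 ≤ γ) (h1 : γ ≤ 1) :
    w n i γ * w n (j + 1) γ ≤ w n j γ * w n (i + 1) γ := by
  rcases Nat.lt_or_ge n (j + 1) with hlt | hge
  · rw [w_eq_zero_of_lt hlt, mul_zero]
    exact mul_nonneg (w_nonneg h0 h1 n j) (w_nonneg h0 h1 n (i + 1))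
  · have hα : 0 ≤ 1 - γ := by linarith
    have hnat : n.choose i * n.choose (j + 1) ≤ n.choose j * n.choose (i + 1) := by
      have hi := Nat.choose_succ_right_eq n i
      have hj := Nat.choose_succ_right_eq n j
      have hpos : 0 < (i + 1) * (j + 1) := by positivity
      apply Nat.le_of_mul_le_mul_right _ hpos
      calc n.choose i * n.choose (j + 1) * ((i + 1) * (j + 1))
          = n.choose i * (i + 1) * (n.choose (j + 1) * (j + 1)) := by ring
        _ = n.choose i * (i + 1) * (n.choose j * (n - j)) := by rw [hj]
        _ = n.choose i * n.choose j * ((i + 1) * (n - j)) := by ring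
        _ ≤ n.choose i * n.choose j * ((j + 1) * (n - i)) :=
            Nat.mul_le_mul_left _ (Nat.mul_le_mul (by omega) (by omega))
        _ = n.choose j * (j + 1) * (n.choose i * (n - i)) := by ring
        _ = n.choose j * (j + 1) * (n.choose (i + 1) * (i + 1)) := by rw [hi]
        _ = n.choose j * n.choose (i + 1) * ((i + 1) * (j + 1)) := by ring
    have hreal : (n.choose i : ℝ) * (n.choose (j + 1) : ℝ) ≤ (n.choose j : ℝ) * (n.choose (i + 1) : ℝ) := by
      exact_mod_cast hnat
    have hexp : (n - i) + (n - (j + 1)) = (n - j) + (n - (i + 1)) := by omega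
    have eL : w n i γ * w n (j + 1) γ
        = ((n.choose i : ℝ) * (n.choose (j + 1) : ℝ)) * (γ ^ (i + (j + 1)) * (1 - γ) ^ ((n - i) + (n - (j + 1)))) := by
      unfold w; ring
    have eR : w n j γ * w n (i + 1) γ
        = ((n.choose j : ℝ) * (n.choose (i + 1) : ℝ)) * (γ ^ (i + (j + 1)) * (1 - γ) ^ ((n - i) + (n - (j + 1)))) := by
      rw [hexp]; unfold w; ring
    rw [eL, eR]
    exact mul_le_mul_of_nonneg_right hreal (by positivity)

/-- The 2×2 Cauchy–Binet (Lagrange) identity for finite sums. [folklore] -/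
theorem lagrange_identity (m : ℕ) (a b c e : ℕ → ℝ) :
    (∑ i ∈ range m, a i * c i) * (∑ i ∈ range m, b i * e i)
      - (∑ i ∈ range m, a i * e i) * (∑ i ∈ range m, b i * c i)
    = (1 / 2) * ∑ i ∈ range m, ∑ j ∈ range m, (a i * b j - a j * b i) * (c i * e j - c j * e i) := by
  have h : ∀ i j, (a i * b j - a j * b i) * (c i * e j - c j * e i)
      = ((a i * c i) * (b j * e j) + (b i * e i) * (a j * c j))
        - ((a i * e i) * (b j * c j) + (b i * c i) * (a j * e j)) := by
    intros; ring
  simp_rw [h]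
  simp only [Finset.sum_add_distrib, Finset.sum_sub_distrib, ← Finset.mul_sum, ← Finset.sum_mul]
  ring

/-- `T_{P,Q}(γ) = P(Bin(P,γ) = Bin(Q,γ)) = Σ_{j < P+Q+1} w P j γ · w Q j γ` (terms with `j > min(P,Q)` vanish).
[folklore] -/
def binCoincidence (P Q : ℕ) (γ : ℝ) : ℝ := ∑ j ∈ range (P + Q + 1), w P j γ * w Q j γ

/-- `d₀ = P(X' = Y')` for `X' ~ Bin(p,γ)`, `Y' ~ Bin(q,γ)` independent, as the finite sum
`Σ_{i < p+q+2} w p i · w q i`. [folklore] -/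
def d0 (p q : ℕ) (γ : ℝ) : ℝ := ∑ i ∈ range (p + q + 2), w p i γ * w q i γ

/-- `d₁ = P(X' - Y' = 1) = Σ_{i < p+q+2} w p (i+1) · w q i`. [folklore] -/
def dPlus (p q : ℕ) (γ : ℝ) : ℝ := ∑ i ∈ range (p + q + 2), w p (i + 1) γ * w q i γ

/-- `d₋₁ = P(X' - Y' = -1) = Σ_{i < p+q+2} w p i · w q (i+1)`. [folklore] -/
def dMinus (p q : ℕ) (γ : ℝ) : ℝ := ∑ i ∈ range (p + q + 2), w p i γ * w q (i + 1) γ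

/-- The shifted diagonal sum: `Σ_{i < p+q+2} w p (i+1) · w q (i+1) = d₀ - w p 0 · w q 0`. [folklore] -/
theorem sum_shift_eq_d0_sub (p q : ℕ) (γ : ℝ) :
    ∑ i ∈ range (p + q + 2), w p (i + 1) γ * w q (i + 1) γ = d0 p q γ - w p 0 γ * w q 0 γ := by
  unfold d0
  rw [Finset.sum_range_succ (fun i => w p (i + 1) γ * w q (i + 1) γ) (p + q + 1),
    Finset.sum_range_succ' (fun i => w p i γ * w q i γ) (p + q + 1)]
  rw [w_eq_zero_of_lt (show p < p + q + 1 + 1 by omega), zero_mul, add_zero]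
  ring

/-- All three `d`-sums are non-negative on `[0,1]`. [folklore] -/
theorem d0_nonneg (p q : ℕ) {γ : ℝ} (h0 : 0 ≤ γ) (h1 : γ ≤ 1) : 0 ≤ d0 p q γ :=
  Finset.sum_nonneg fun i _ => mul_nonneg (w_nonneg h0 h1 p i) (w_nonneg h0 h1 q i)

/-- [folklore] -/
theorem dPlus_nonneg (p q : ℕ) {γ : ℝ} (h0 : 0 ≤ γ) (h1 : γ ≤ 1) : 0 ≤ dPlus p q γ :=
  Finset.sum_nonneg fun i _ => mul_nonneg (w_nonneg h0 h1 p (i + 1)) (w_nonneg h0 h1 q i)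

/-- [folklore] -/
theorem dMinus_nonneg (p q : ℕ) {γ : ℝ} (h0 : 0 ≤ γ) (h1 : γ ≤ 1) : 0 ≤ dMinus p q γ :=
  Finset.sum_nonneg fun i _ => mul_nonneg (w_nonneg h0 h1 p i) (w_nonneg h0 h1 q (i + 1))

/-- `d₀ ≥ w p 0 · w q 0 = (1-γ)^(p+q) > 0` for `γ ∈ [0,1)`. [folklore] -/
theorem d0_pos (p q : ℕ) {γ : ℝ} (h0 : 0 ≤ γ) (h1 : γ < 1) : 0 < d0 p q γ := by
  have hle : w p 0 γ * w q 0 γ ≤ d0 p q γ := by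
    have := sum_shift_eq_d0_sub p q γ
    have hnn : 0 ≤ ∑ i ∈ range (p + q + 2), w p (i + 1) γ * w q (i + 1) γ :=
      Finset.sum_nonneg fun i _ => mul_nonneg (w_nonneg h0 h1.le p (i + 1)) (w_nonneg h0 h1.le q (i + 1))
    linarith
  have hpos : 0 < w p 0 γ * w q 0 γ := by
    rw [w_at_zero, w_at_zero]
    have : 0 < 1 - γ := by linarith
    positivity
  linarith

/-- The mean identity (I1) of DMONO-ALLX §3: `(p+1)(1-γ) d₋₁ + (p+1)γ d₀ = (q+1)(1-γ) d₁ + (q+1)γ d₀`, i.e.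
`P(1-γ) d₋₁ + γ(P-Q) d₀ = Q(1-γ) d₁` (from `E[z^{X'-Y'}]`: `z·f'(z)` has no constant term). [folklore] -/
theorem dLaw_mean_identity (p q : ℕ) (γ : ℝ) :
    ((p : ℝ) + 1) * (1 - γ) * dMinus p q γ + ((p : ℝ) + 1) * γ * d0 p q γ
      = ((q : ℝ) + 1) * (1 - γ) * dPlus p q γ + ((q : ℝ) + 1) * γ * d0 p q γ := by
  have hL : ((p : ℝ) + 1) * (1 - γ) * dMinus p q γ + ((p : ℝ) + 1) * γ * d0 p q γ
      = ∑ i ∈ range (p + q + 2), ((p : ℝ) + 1) * (w p i γ * w (q + 1) (i + 1) γ) := by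
    unfold dMinus d0
    rw [Finset.mul_sum, Finset.mul_sum, ← Finset.sum_add_distrib]
    refine Finset.sum_congr rfl fun i _ => ?_
    rw [w_succ_succ q i]; ring
  have hR : ((q : ℝ) + 1) * (1 - γ) * dPlus p q γ + ((q : ℝ) + 1) * γ * d0 p q γ
      = ∑ i ∈ range (p + q + 2), ((q : ℝ) + 1) * (w (p + 1) (i + 1) γ * w q i γ) := by
    unfold dPlus d0
    rw [Finset.mul_sum, Finset.mul_sum, ← Finset.sum_add_distrib]
    refine Finset.sum_congr rfl fun i _ => ?_
    rw [w_succ_succ p i]; ring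
  rw [hL, hR]
  exact Finset.sum_congr rfl fun i _ => absorb_swap p q i γ

/-- Log-concavity input (LC) of DMONO-ALLX §3: `d₁ · d₋₁ ≤ d₀ (d₀ - w p 0 · w q 0) ≤ d₀²` on `[0,1]`
(2×2 Cauchy–Binet + `w_ratio_mono`; probabilistically: `X' - Y' + q` is a sum of independent Bernoulli variables,
hence has a log-concave law). [folklore] -/
theorem dLaw_lc (p q : ℕ) {γ : ℝ} (h0 : 0 ≤ γ) (h1 : γ ≤ 1) :
    dPlus p q γ * dMinus p q γ ≤ d0 p q γ * (d0 p q γ - w p 0 γ * w q 0 γ) := by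
  have hlag := lagrange_identity (p + q + 2) (fun i => w p i γ) (fun i => w p (i + 1) γ)
    (fun i => w q i γ) (fun i => w q (i + 1) γ)
  have hnn : 0 ≤ ∑ i ∈ range (p + q + 2), ∑ j ∈ range (p + q + 2),
      (w p i γ * w p (j + 1) γ - w p j γ * w p (i + 1) γ) * (w q i γ * w q (j + 1) γ - w q j γ * w q (i + 1) γ) := by
    refine Finset.sum_nonneg fun i _ => Finset.sum_nonneg fun j _ => ?_
    rcases Nat.lt_or_ge j i with hji | hij
    · have hs := w_ratio_mono p hji.le h0 h1
      have ht := w_ratio_mono q hji.le h0 h1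
      nlinarith
    · have hs := w_ratio_mono p hij h0 h1
      have ht := w_ratio_mono q hij h0 h1
      nlinarith
  rw [← sum_shift_eq_d0_sub]
  unfold dPlus dMinus d0
  nlinarith [hlag, hnn]

/-- `E(γ) = A (d₀ - d₋₁) + B (d₀ - d₁)` with `A = (p+1)(1-γ) - (q+1)γ`, `B = (q+1)(1-γ) - (p+1)γ`
(DMONO-ALLX (3.2)); `-E` is the derivative of `T_{p+1,q+1}`. [folklore] -/
def E (p q : ℕ) (γ : ℝ) : ℝ :=
  (((p : ℝ) + 1) * (1 - γ) - ((q : ℝ) + 1) * γ) * (d0 p q γ - dMinus p q γ)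
    + (((q : ℝ) + 1) * (1 - γ) - ((p : ℝ) + 1) * γ) * (d0 p q γ - dPlus p q γ)

/-- The raw derivative of `T_{p+1,q+1}` as delivered by the product rule. [folklore] -/
def Tderiv (p q : ℕ) (γ : ℝ) : ℝ :=
  (∑ i ∈ range (p + q + 2),
      (((p : ℝ) + 1) * (w p i γ - w p (i + 1) γ) * w (q + 1) (i + 1) γ
        + w (p + 1) (i + 1) γ * (((q : ℝ) + 1) * (w q i γ - w q (i + 1) γ))))
    + (-(((p : ℝ) + 1) * w p 0 γ) * w (q + 1) 0 γ + w (p + 1) 0 γ * -(((q : ℝ) + 1) * w q 0 γ))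

/-- `T_{p+1,q+1}` has derivative `Tderiv p q γ` at every `γ`. [folklore] -/
theorem hasDerivAt_binCoincidence_raw (p q : ℕ) (γ : ℝ) :
    HasDerivAt (binCoincidence (p + 1) (q + 1)) (Tderiv p q γ) γ := by
  have hfun : binCoincidence (p + 1) (q + 1)
      = fun x => (∑ i ∈ range (p + q + 2), w (p + 1) (i + 1) x * w (q + 1) (i + 1) x)
          + w (p + 1) 0 x * w (q + 1) 0 x := by
    ext x
    unfold binCoincidence
    rw [show p + 1 + (q + 1) + 1 = (p + q + 2) + 1 by ring, Finset.sum_range_succ']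
  rw [hfun]
  unfold Tderiv
  refine HasDerivAt.add ?_ ((hasDerivAt_w_zero p γ).mul (hasDerivAt_w_zero q γ))
  exact HasDerivAt.fun_sum (u := range (p + q + 2))
    (A := fun i x => w (p + 1) (i + 1) x * w (q + 1) (i + 1) x)
    fun i _ => (hasDerivAt_w_succ p i γ).mul (hasDerivAt_w_succ q i γ)

/-- The derivative identity (3.2) of DMONO-ALLX: `Tderiv = -E`. [folklore] -/
theorem Tderiv_eq_neg_E (p q : ℕ) (γ : ℝ) : Tderiv p q γ = -E p q γ := by
  unfold Tderiv E
  have hs : ∀ i ∈ range (p + q + 2),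
      (((p : ℝ) + 1) * (w p i γ - w p (i + 1) γ) * w (q + 1) (i + 1) γ
        + w (p + 1) (i + 1) γ * (((q : ℝ) + 1) * (w q i γ - w q (i + 1) γ)))
      = ((p : ℝ) + 1 + ((q : ℝ) + 1)) * γ * (w p i γ * w q i γ)
        + (((p : ℝ) + 1) * (1 - γ) - ((q : ℝ) + 1) * γ) * (w p i γ * w q (i + 1) γ)
        + (((q : ℝ) + 1) * (1 - γ) - ((p : ℝ) + 1) * γ) * (w p (i + 1) γ * w q i γ)
        - ((p : ℝ) + 1 + ((q : ℝ) + 1)) * (1 - γ) * (w p (i + 1) γ * w q (i + 1) γ) := by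
    intro i _
    rw [w_succ_succ p i, w_succ_succ q i]; ring
  rw [Finset.sum_congr rfl hs]
  simp only [Finset.sum_add_distrib, Finset.sum_sub_distrib, ← Finset.mul_sum]
  rw [sum_shift_eq_d0_sub, w_succ_zero p, w_succ_zero q]
  unfold d0 dPlus dMinus
  ring

/-- **Derivative of the binomial coincidence probability** (DMONO-ALLX (3.2)): for `P = p+1`, `Q = q+1`,
`T'_{P,Q}(γ) = -(A (d₀ - d₋₁) + B (d₀ - d₁))`. [folklore] -/
theorem hasDerivAt_binCoincidence (p q : ℕ) (γ : ℝ) :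
    HasDerivAt (binCoincidence (p + 1) (q + 1)) (-E p q γ) γ := by
  have h := hasDerivAt_binCoincidence_raw p q γ
  rwa [Tderiv_eq_neg_E] at h

-- `core_ineq` is split into three private pieces (root comparison; case `δ₀ ≤ δ₁`; case `δ₁ < δ₀`).  The hub's
-- full build runs SYNCHRONOUSLY (`set_option Elab.async false`) and there `core_ineq_of_gt` (the `nlinarith`-heavy
-- case `δ₁ < δ₀`) deterministically exceeds the default `maxHeartbeats 200000` (gate4 build-broken event
-- 2026-08-19T18:04Z, line 475) although it passes verify; it therefore carries a DECLARATION-SCOPED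
-- `set_option maxHeartbeats 400000 in` (gate4's prescribed repair).  No file-scoped option remains.

/-- Root comparison of DMONO-ALLX §3 Step 4 (`r ≤ A/B`): if `B = Q(1-γ) - Pγ > 0` then `B δ₊ ≤ A δ₀`, from the mean
identity (I1) and log-concavity (LC).  Private helper for `core_ineq`. [folklore] -/
private theorem core_ineq_rootcmp (P Q γ δ0 δ1 δm : ℝ) (hPQ : Q ≤ P) (hQ : 1 ≤ Q) (hγ0 : 0 < γ)
    (hγ : γ ≤ 1 / 2) (h0 : 0 < δ0)
    (hI1 : P * (1 - γ) * δm + P * γ * δ0 = Q * (1 - γ) * δ1 + Q * γ * δ0)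
    (hLC : δ1 * δm ≤ δ0 ^ 2) (hB : 0 < Q * (1 - γ) - P * γ) :
    (Q * (1 - γ) - P * γ) * δ1 ≤ (P * (1 - γ) - Q * γ) * δ0 := by
  have hP : 1 ≤ P := le_trans hQ hPQ
  have hα0 : 0 < 1 - γ := by linarith
  have hPα : 0 < P * (1 - γ) := mul_pos (by linarith) hα0
  have hQα : 0 < Q * (1 - γ) := mul_pos (by linarith) hα0
  by_contra hx
  push Not at hx
  have e : Q * (1 - γ) * δ1 ^ 2 - γ * (P - Q) * δ1 * δ0 - P * (1 - γ) * δ0 ^ 2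
      = P * (1 - γ) * (δ1 * δm - δ0 ^ 2) := by linear_combination (-δ1) * hI1
  have hQ1 : Q * (1 - γ) * δ1 ^ 2 - γ * (P - Q) * δ1 * δ0 - P * (1 - γ) * δ0 ^ 2 ≤ 0 := by
    rw [e]; exact mul_nonpos_of_nonneg_of_nonpos hPα.le (by linarith)
  have hQ2 : Q * (1 - γ) * (P * (1 - γ) - Q * γ) ^ 2
        - γ * (P - Q) * (P * (1 - γ) - Q * γ) * (Q * (1 - γ) - P * γ)
        - P * (1 - γ) * (Q * (1 - γ) - P * γ) ^ 2
      = (P - Q) * P * Q * (1 - 2 * γ) := by ring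
  have hQ2' : 0 ≤ (P - Q) * P * Q * (1 - 2 * γ) := by
    have h3 : 0 ≤ (P - Q) * P * Q :=
      mul_nonneg (mul_nonneg (by linarith) (by linarith)) (by linarith)
    exact mul_nonneg h3 (by linarith)
  have hPγ : 0 ≤ P * γ := mul_nonneg (by linarith) hγ0.le
  have s1 : γ * (P - Q) * (Q * (1 - γ) - P * γ) ≤ γ * (P - Q) * (Q * (1 - γ)) :=
    mul_le_mul_of_nonneg_left (by linarith) (mul_nonneg hγ0.le (by linarith))
  have s2 : 0 ≤ Q * (1 - γ) * (2 * P * (1 - γ) - γ * P - Q * γ) := by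
    have u1 : 0 ≤ (P - Q) * (2 - 3 * γ) := mul_nonneg (by linarith) (by linarith)
    have u2 : 0 ≤ Q * (2 - 4 * γ) := mul_nonneg (by linarith) (by linarith)
    exact mul_nonneg hQα.le (by linarith)
  have hW : 0 ≤ 2 * (Q * (1 - γ)) * (P * (1 - γ) - Q * γ) - γ * (P - Q) * (Q * (1 - γ) - P * γ) := by
    linarith [s1, s2]
  have hΔ : (Q * (1 - γ) - P * γ) ^ 2
        * (Q * (1 - γ) * δ1 ^ 2 - γ * (P - Q) * δ1 * δ0 - P * (1 - γ) * δ0 ^ 2)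
        - δ0 ^ 2 * ((P - Q) * P * Q * (1 - 2 * γ))
      = ((Q * (1 - γ) - P * γ) * δ1 - (P * (1 - γ) - Q * γ) * δ0)
        * (Q * (1 - γ) * ((Q * (1 - γ) - P * γ) * δ1 + (P * (1 - γ) - Q * γ) * δ0)
            - γ * (P - Q) * δ0 * (Q * (1 - γ) - P * γ)) := by
    rw [← hQ2]; ring
  have hL : (Q * (1 - γ) - P * γ) ^ 2
        * (Q * (1 - γ) * δ1 ^ 2 - γ * (P - Q) * δ1 * δ0 - P * (1 - γ) * δ0 ^ 2)
        - δ0 ^ 2 * ((P - Q) * P * Q * (1 - 2 * γ)) ≤ 0 := by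
    have u1 : (Q * (1 - γ) - P * γ) ^ 2
        * (Q * (1 - γ) * δ1 ^ 2 - γ * (P - Q) * δ1 * δ0 - P * (1 - γ) * δ0 ^ 2) ≤ 0 :=
      mul_nonpos_of_nonneg_of_nonpos (sq_nonneg _) hQ1
    have u2 : 0 ≤ δ0 ^ 2 * ((P - Q) * P * Q * (1 - 2 * γ)) := mul_nonneg (sq_nonneg _) hQ2'
    linarith
  have hbr : 0 < Q * (1 - γ) * ((Q * (1 - γ) - P * γ) * δ1 + (P * (1 - γ) - Q * γ) * δ0)
        - γ * (P - Q) * δ0 * (Q * (1 - γ) - P * γ) := by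
    have v1 := mul_lt_mul_of_pos_left hx hQα
    have v2 : 0 ≤ δ0 * (2 * (Q * (1 - γ)) * (P * (1 - γ) - Q * γ)
        - γ * (P - Q) * (Q * (1 - γ) - P * γ)) := mul_nonneg h0.le hW
    linarith [v1, v2]
  have hR : 0 < ((Q * (1 - γ) - P * γ) * δ1 - (P * (1 - γ) - Q * γ) * δ0)
        * (Q * (1 - γ) * ((Q * (1 - γ) - P * γ) * δ1 + (P * (1 - γ) - Q * γ) * δ0)
            - γ * (P - Q) * δ0 * (Q * (1 - γ) - P * γ)) := mul_pos (by linarith) hbr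
  rw [← hΔ] at hR
  linarith

/-- `core_ineq`, case `δ₀ ≤ δ₊` (so `δ₊ > 0` and, by (LC), `δ₋ ≤ δ₀`).  Private helper for `core_ineq`. [folklore] -/
private theorem core_ineq_of_le (P Q γ δ0 δ1 δm : ℝ) (hPQ : Q ≤ P) (hQ : 1 ≤ Q) (hγ0 : 0 < γ)
    (hγ : γ ≤ 1 / 2) (h0 : 0 < δ0) (hm : 0 ≤ δm)
    (hI1 : P * (1 - γ) * δm + P * γ * δ0 = Q * (1 - γ) * δ1 + Q * γ * δ0)
    (hLC : δ1 * δm ≤ δ0 ^ 2) (hc : δ0 ≤ δ1) :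
    0 ≤ (P * (1 - γ) - Q * γ) * (δ0 - δm) + (Q * (1 - γ) - P * γ) * (δ0 - δ1) := by
  have hP : 1 ≤ P := le_trans hQ hPQ
  have hγα : γ ≤ 1 - γ := by linarith
  have hα0 : 0 < 1 - γ := by linarith
  have hPα : 0 < P * (1 - γ) := mul_pos (by linarith) hα0
  have hQα : 0 < Q * (1 - γ) := mul_pos (by linarith) hα0
  have hA : 0 ≤ P * (1 - γ) - Q * γ := by nlinarith
  have h1pos : 0 < δ1 := lt_of_lt_of_le h0 hc
  have hmle : δm ≤ δ0 := by
    by_contra hx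
    push Not at hx
    have : δ0 * δ0 < δ1 * δm := by nlinarith [hm]
    nlinarith
  rcases le_or_gt (Q * (1 - γ) - P * γ) 0 with hB | hB
  · have t1 : 0 ≤ (P * (1 - γ) - Q * γ) * (δ0 - δm) := mul_nonneg hA (by linarith)
    have t2 : 0 ≤ (Q * (1 - γ) - P * γ) * (δ0 - δ1) :=
      mul_nonneg_of_nonpos_of_nonpos hB (by linarith)
    linarith
  · -- B > 0: first B δ₁ ≤ A δ₀ (the root comparison `r ≤ A/B` of DMONO-ALLX), then conclude.
    have hBA : (Q * (1 - γ) - P * γ) * δ1 ≤ (P * (1 - γ) - Q * γ) * δ0 :=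
      core_ineq_rootcmp P Q γ δ0 δ1 δm hPQ hQ hγ0 hγ h0 hI1 hLC hB
    have key : 0 ≤ δ1 * ((P * (1 - γ) - Q * γ) * (δ0 - δm) + (Q * (1 - γ) - P * γ) * (δ0 - δ1)) := by
      have u1 : (P * (1 - γ) - Q * γ) * (δ1 * δm) ≤ (P * (1 - γ) - Q * γ) * δ0 ^ 2 :=
        mul_le_mul_of_nonneg_left hLC hA
      have u2 : 0 ≤ (δ1 - δ0) * ((P * (1 - γ) - Q * γ) * δ0 - (Q * (1 - γ) - P * γ) * δ1) :=
        mul_nonneg (by linarith) (by linarith)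
      linarith [u1, u2]
    exact le_of_mul_le_mul_left (by rw [mul_zero]; exact key) h1pos

set_option maxHeartbeats 400000 in
/-- `core_ineq`, case `δ₊ < δ₀` (so, by (I1), `δ₋ ≤ δ₀`; for `B < 0`, `P(1-γ)·E` is affine in `δ₊ ∈ [0, δ₀]` with
non-negative endpoint values).  Private helper for `core_ineq`. [folklore] -/
private theorem core_ineq_of_gt (P Q γ δ0 δ1 δm : ℝ) (hPQ : Q ≤ P) (hQ : 1 ≤ Q) (hγ0 : 0 < γ)
    (hγ : γ ≤ 1 / 2) (h0 : 0 < δ0) (h1 : 0 ≤ δ1)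
    (hI1 : P * (1 - γ) * δm + P * γ * δ0 = Q * (1 - γ) * δ1 + Q * γ * δ0)
    (hc : δ1 < δ0) :
    0 ≤ (P * (1 - γ) - Q * γ) * (δ0 - δm) + (Q * (1 - γ) - P * γ) * (δ0 - δ1) := by
  have hP : 1 ≤ P := le_trans hQ hPQ
  have hγα : γ ≤ 1 - γ := by linarith
  have hα0 : 0 < 1 - γ := by linarith
  have hPα : 0 < P * (1 - γ) := mul_pos (by linarith) hα0
  have hQα : 0 < Q * (1 - γ) := mul_pos (by linarith) hα0
  have hA : 0 ≤ P * (1 - γ) - Q * γ := by nlinarith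
  have hAB : 0 ≤ (P * (1 - γ) - Q * γ) + (Q * (1 - γ) - P * γ) := by nlinarith
  have hmle : δm ≤ δ0 := by
    by_contra hx
    push Not at hx
    have v1 := mul_lt_mul_of_pos_left hx hPα
    have v2 : Q * (1 - γ) * δ1 ≤ Q * (1 - γ) * δ0 := mul_le_mul_of_nonneg_left hc.le hQα.le
    have v3 : Q * (1 - γ) * δ0 ≤ P * (1 - γ) * δ0 :=
      mul_le_mul_of_nonneg_right (mul_le_mul_of_nonneg_right hPQ hα0.le) h0.le
    have v4 : 0 ≤ (P - Q) * γ * δ0 := mul_nonneg (mul_nonneg (by linarith) hγ0.le) h0.le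
    linarith [hI1, v1, v2, v3, v4]
  rcases le_or_gt 0 (Q * (1 - γ) - P * γ) with hB | hB
  · have t1 : 0 ≤ (P * (1 - γ) - Q * γ) * (δ0 - δm) := mul_nonneg hA (by linarith)
    have t2 : 0 ≤ (Q * (1 - γ) - P * γ) * (δ0 - δ1) := mul_nonneg hB (by linarith)
    linarith
  · -- B < 0: `P(1-γ)·E` is affine in δ₁ ∈ [0, δ₀] with non-negative endpoint values.
    have eE : P * (1 - γ) * ((P * (1 - γ) - Q * γ) * (δ0 - δm) + (Q * (1 - γ) - P * γ) * (δ0 - δ1))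
        = (P * (1 - γ) - Q * γ) * (P * (1 - γ) * δ0 - Q * (1 - γ) * δ1 + γ * (P - Q) * δ0)
          + (Q * (1 - γ) - P * γ) * (P * (1 - γ)) * (δ0 - δ1) := by
      linear_combination (-(P * (1 - γ) - Q * γ)) * hI1
    have hint : δ0 * ((P * (1 - γ) - Q * γ) * (P * (1 - γ) * δ0 - Q * (1 - γ) * δ1 + γ * (P - Q) * δ0)
          + (Q * (1 - γ) - P * γ) * (P * (1 - γ)) * (δ0 - δ1))
        = (δ0 - δ1) * (δ0 * (P * (1 - γ) * ((P * (1 - γ) - Q * γ) + (Q * (1 - γ) - P * γ))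
            + γ * (P - Q) * (P * (1 - γ) - Q * γ)))
          + δ1 * ((P * (1 - γ) - Q * γ) * δ0 * (P - Q)) := by
      ring
    have hK : 0 ≤ P * (1 - γ) * ((P * (1 - γ) - Q * γ) + (Q * (1 - γ) - P * γ))
            + γ * (P - Q) * (P * (1 - γ) - Q * γ) := by
      have u1 : 0 ≤ P * (1 - γ) * ((P * (1 - γ) - Q * γ) + (Q * (1 - γ) - P * γ)) :=
        mul_nonneg hPα.le hAB
      have u2 : 0 ≤ γ * (P - Q) * (P * (1 - γ) - Q * γ) :=
        mul_nonneg (mul_nonneg hγ0.le (by linarith)) hA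
      linarith
    have hsum : 0 ≤ (δ0 - δ1) * (δ0 * (P * (1 - γ) * ((P * (1 - γ) - Q * γ) + (Q * (1 - γ) - P * γ))
            + γ * (P - Q) * (P * (1 - γ) - Q * γ)))
          + δ1 * ((P * (1 - γ) - Q * γ) * δ0 * (P - Q)) := by
      have u1 := mul_nonneg (sub_nonneg.2 hc.le) (mul_nonneg h0.le hK)
      have u2 : 0 ≤ δ1 * ((P * (1 - γ) - Q * γ) * δ0 * (P - Q)) :=
        mul_nonneg h1 (mul_nonneg (mul_nonneg hA h0.le) (by linarith))
      linarith
    rw [← hint] at hsum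
    -- hsum : 0 ≤ δ0 * X with X = P(1-γ)·E; δ0 > 0, P(1-γ) > 0
    have hX : 0 ≤ (P * (1 - γ) - Q * γ) * (P * (1 - γ) * δ0 - Q * (1 - γ) * δ1 + γ * (P - Q) * δ0)
          + (Q * (1 - γ) - P * γ) * (P * (1 - γ)) * (δ0 - δ1) :=
      le_of_mul_le_mul_left (by rw [mul_zero]; exact hsum) h0
    rw [← eE] at hX
    exact le_of_mul_le_mul_left (by rw [mul_zero]; exact hX) hPα

/-- The real-algebra core of DMONO-ALLX §3 Step 4: from the mean identity (I1) and log-concavity (LC) alone,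
`E = A (δ₀ - δ₋) + B (δ₀ - δ₊) ≥ 0` whenever `P ≥ Q ≥ 1` and `0 < γ ≤ 1/2` (division-free case analysis). [folklore] -/
theorem core_ineq (P Q γ δ0 δ1 δm : ℝ) (hPQ : Q ≤ P) (hQ : 1 ≤ Q) (hγ0 : 0 < γ) (hγ : γ ≤ 1 / 2)
    (h0 : 0 < δ0) (h1 : 0 ≤ δ1) (hm : 0 ≤ δm)
    (hI1 : P * (1 - γ) * δm + P * γ * δ0 = Q * (1 - γ) * δ1 + Q * γ * δ0)
    (hLC : δ1 * δm ≤ δ0 ^ 2) :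
    0 ≤ (P * (1 - γ) - Q * γ) * (δ0 - δm) + (Q * (1 - γ) - P * γ) * (δ0 - δ1) := by
  rcases le_or_gt δ0 δ1 with hc | hc
  · exact core_ineq_of_le P Q γ δ0 δ1 δm hPQ hQ hγ0 hγ h0 hm hI1 hLC hc
  · exact core_ineq_of_gt P Q γ δ0 δ1 δm hPQ hQ hγ0 hγ h0 h1 hI1 hc

/-- `E ≥ 0` on `(0, 1/2]` for `q ≤ p` (DMONO-ALLX §3 Step 4). [folklore] -/
theorem E_nonneg {p q : ℕ} (hpq : q ≤ p) {γ : ℝ} (hγ0 : 0 < γ) (hγ : γ ≤ 1 / 2) : 0 ≤ E p q γ := by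
  have h1 : γ ≤ 1 := by linarith
  have hLC : dPlus p q γ * dMinus p q γ ≤ d0 p q γ ^ 2 := by
    have := dLaw_lc p q hγ0.le h1
    have hu : 0 ≤ w p 0 γ * w q 0 γ := mul_nonneg (w_nonneg hγ0.le h1 p 0) (w_nonneg hγ0.le h1 q 0)
    have hd := d0_nonneg p q hγ0.le h1
    nlinarith
  unfold E
  exact core_ineq ((p : ℝ) + 1) ((q : ℝ) + 1) γ (d0 p q γ) (dPlus p q γ) (dMinus p q γ)
    (by exact_mod_cast Nat.succ_le_succ hpq) (by simp) hγ0 hγ (d0_pos p q hγ0.le (by linarith))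
    (dPlus_nonneg p q hγ0.le h1) (dMinus_nonneg p q hγ0.le h1) (dLaw_mean_identity p q γ) hLC

/-- Monotonicity for `P = p+1 ≥ Q = q+1 ≥ 1`. [folklore] -/
theorem binCoincidence_antitoneOn_of_le {p q : ℕ} (hpq : q ≤ p) :
    AntitoneOn (binCoincidence (p + 1) (q + 1)) (Icc (0 : ℝ) (1 / 2)) := by
  have hderiv : ∀ x, HasDerivAt (binCoincidence (p + 1) (q + 1)) (-E p q x) x :=
    hasDerivAt_binCoincidence p q
  apply antitoneOn_of_deriv_nonpos (convex_Icc (0 : ℝ) (1 / 2))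
  · exact fun x _ => (hderiv x).continuousAt.continuousWithinAt
  · exact fun x _ => (hderiv x).differentiableAt.differentiableWithinAt
  · intro x hx
    rw [interior_Icc] at hx
    rw [(hderiv x).deriv]
    have := E_nonneg hpq hx.1 hx.2.le
    linarith

/-- Symmetry `T_{P,Q} = T_{Q,P}`. [folklore] -/
theorem binCoincidence_comm (P Q : ℕ) (γ : ℝ) : binCoincidence P Q γ = binCoincidence Q P γ := by
  unfold binCoincidence
  rw [Nat.add_comm Q P]
  exact Finset.sum_congr rfl fun j _ => mul_comm _ _

/-- `T_{P,0}(γ) = (1-γ)^P`. [folklore] -/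
theorem binCoincidence_zero_right (P : ℕ) (γ : ℝ) : binCoincidence P 0 γ = (1 - γ) ^ P := by
  unfold binCoincidence
  rw [Nat.add_zero, Finset.sum_range_succ']
  have hz : ∑ j ∈ range P, w P (j + 1) γ * w 0 (j + 1) γ = 0 :=
    Finset.sum_eq_zero fun j _ => by rw [w_eq_zero_of_lt (Nat.succ_pos j) γ, mul_zero]
  rw [hz, w_zero_zero, w_at_zero]; ring

/-- `T_{0,Q}(γ) = (1-γ)^Q`. [folklore] -/
theorem binCoincidence_zero_left (Q : ℕ) (γ : ℝ) : binCoincidence 0 Q γ = (1 - γ) ^ Q := by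
  rw [binCoincidence_comm, binCoincidence_zero_right]

/-- `T_{P,Q}(γ) ≥ 0` for `γ ∈ [0,1]` (a sum of products of binomial weights). [folklore] -/
theorem binCoincidence_nonneg (P Q : ℕ) {γ : ℝ} (h0 : 0 ≤ γ) (h1 : γ ≤ 1) : 0 ≤ binCoincidence P Q γ :=
  Finset.sum_nonneg fun j _ => mul_nonneg (w_nonneg h0 h1 P j) (w_nonneg h0 h1 Q j)

/-- `T_{P,Q}(0) = 1`: at `γ = 0` both binomials are `0` almost surely (the value at the left end of the
monotonicity interval; used by consumers to normalise). [folklore] -/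
theorem binCoincidence_at_zero (P Q : ℕ) : binCoincidence P Q 0 = 1 := by
  unfold binCoincidence
  rw [Finset.sum_range_succ']
  have hz : ∑ j ∈ range (P + Q), w P (j + 1) 0 * w Q (j + 1) 0 = 0 :=
    Finset.sum_eq_zero fun j _ => by simp [w]
  rw [hz, w_at_zero, w_at_zero]; ring

/-- **The two-coordinate core of d-monotonicity for every endpoint** (DMONO-ALLX Theorem A in binomial form):
for all `P Q : ℕ`, the coincidence probability `γ ↦ P(Bin(P,γ) = Bin(Q,γ))` is non-increasing on `[0, 1/2]`.
Equivalently: for the planar walk stepping in coordinate 1 with probability `1-γ` and in coordinate 2 with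
probability `γ`, the `M`-step probability of `(a,0)` is non-increasing in `γ ∈ [0,1/2]` for every `M, a`; chained over
`d` rate transfers this gives `p_N^{(d+1)}((x,0)) ≤ p_N^{(d)}(x)` for every `x` (DMONO-ALLX §4), the statement that
[FvdH21] §9 could prove only for `‖x‖_∞ ≤ 2` (Lemma 9.2, via Bessel functions).
[cite: FitznerVanDerHofstad2021LTLA, §9 Def. 9.1 / Lemma 9.2 (context; this lemma is the new analytic input)] -/
theorem binCoincidence_antitoneOn (P Q : ℕ) :
    AntitoneOn (binCoincidence P Q) (Icc (0 : ℝ) (1 / 2)) := by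
  -- reduce to `P ≥ Q` by symmetry
  wlog hQP : Q ≤ P generalizing P Q with H
  · have h := H Q P (le_of_not_ge hQP)
    have hfun : binCoincidence P Q = binCoincidence Q P := funext fun γ => binCoincidence_comm P Q γ
    rw [hfun]; exact h
  rcases Q with _ | q
  · -- `Q = 0`: `T = (1-γ)^P`
    intro x hx y hy hxy
    have hfun : ∀ γ, binCoincidence P 0 γ = (1 - γ) ^ P := binCoincidence_zero_right P
    rw [hfun, hfun]
    have hy1 : 0 ≤ 1 - y := by have := hy.2; linarith
    exact pow_le_pow_left₀ hy1 (by linarith) P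
  · rcases P with _ | p
    · exact absurd hQP (by omega)
    · exact binCoincidence_antitoneOn_of_le (by omega)

end BinCoincidence

/-- Export under the chapter namespace: `T_{P,Q}` is antitone on `[0,1/2]` (see `BinCoincidence.binCoincidence`).
[cite: FitznerVanDerHofstad2021LTLA, §9 Def. 9.1 / Lemma 9.2 (context)] -/
theorem binomialCoincidence_antitoneOn (P Q : ℕ) :
    AntitoneOn (BinCoincidence.binCoincidence P Q) (Icc (0 : ℝ) (1 / 2)) :=
  BinCoincidence.binCoincidence_antitoneOn P Q

end Literature.Probability.FitznerVanDerHofstad2017
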